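import Literature.MathematicalPhysics.QuantumFieldTheory.Balaban1983to89.B7Prop6Flat
import Literature.MathematicalPhysics.QuantumFieldTheory.Balaban1983to89.B7Transfer
import Literature.MathematicalPhysics.QuantumFieldTheory.Balaban1983to89.B8Ineq130

/-!
# Bałaban's renormalization group for 4-d lattice Yang–Mills — B7 Sects. B–C AT AN ARBITRARY BACKGROUND `V₀`/`U₀`: the
CONCRETE covariant averaging objects — the rotations (56)–(57), the moving-frame gauge action (55), the `R₀`-twisted
transport (58), the block frames `\overline{R_{0,y}V₁}` (82), the averages `Ṽ₁` (65)/(69), the double-bar averages (89)–(91),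
the accumulated frames (97) — for B7's OWN average (42)/(43) on `ℤ^d`, and the FUNDAMENTAL EQUALITY (92)/(97)
`Ũ₁^j = (U̿₁^j)^{v_j}` for every `j`, AS IDENTITIES OF THE FORMAL OBJECTS (no smallness, no unitarity); at `U₀ = 1` they
reduce to `B7Prop3Flat`/`B7Prop4Flat`/`B7Prop6Flat` (`B7Eq92Concrete`)

CITATION HEADER (lean-in-tree rule 2026-08-18).  Audit cell `pub-balaban`, paper sub-cell B07 (unit b2b-balaban-b07,
gen 19).  Source: T. Bałaban, *Averaging operations for lattice gauge theories*, Commun. Math. Phys. **98**, 17–51 (1985)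
[Balaban1985Averaging] (cell paper B7; journal page = PDF page + 16), Sect. B pp. 27–29 [PDF 11–13] ((55)–(71)), Sect. C
pp. 30–32 [PDF 14–16] ((77)–(100)) and Sect. E p. 42 [PDF 26] ((159)–(160)), quoted from the page renders
`b2b-balaban-ref1/pages/1985-cmp98-averaging/1985-cmp98-averaging-p011-x2.png` … `-p016-x2.png` and `-p026-x2.png` READ AS
IMAGES (2026-08-19, this unit); (8), (9), (11), (42)–(43) and p. 24 as read and quoted by gens 12–19 of this lineage
(module docstrings of the companions).
Companions (all REUSED BY NAME, none modified): `B7Prop6Flat` (gen 19: `mlog_conj` — the series (21) is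
conjugation-covariant for EVERY unit —, `bavg_gaugeAct_units`/`avgIter_gaugeAct_units` — (11) for the averages (42)/(43)
under EVERY invertible gauge function —, the flat accumulated frame `vprod` (160) and (159) at `U₀ = 1`
`avgIter_eq_gaugeAct_vprod`), `B7Prop4Flat` (`dbavgIter` = (90)/(91) at `U₀ = 1`), `B7Prop3Flat` (`Favg`/`vframe` = the
block frame (110) = (82) at `V₀ = 1`, `dbavg` = (89) at `V₀ = 1`), `B7Prop2Explicit` (`avgIter` = `Ū^k` (43) read on the unit
lattices, `rescale`), `B7Prop1Explicit` (`hol` (9), `gaugeAct` (8), `bavg`/`Xavg`/`Wcx` (42), `expUnit`, `treeWord`/`boxVec`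
= the tree contours `Γ_{y,x}` and the blocks `B(y)`), `B7AvgGaugeCovariance` (`uLev`), `MatrixLog` (`mlog` = the series
(21)), `B8Ineq130` (only its bookkeeping `hol_one`, `bavg_one`: `1(Γ) = 1`, `1̄ = 1`), and `B7Transfer` (unit b07 gens 2–3: the ABSTRACT transfer skeleton of Sect. C over an arbitrary group — `frame`,
`dbar`, `avg_eq_frame_dbar`, `step98`, `step99` — whose hypotheses `hcov` (93) and `hT` are explicit binders there; HERE
`hcov` and `hT` are DISCHARGED for B7's own average and transport: `hcov_concrete`, `tHol_mgauge`).

THE PRINTED TEXT (verbatim from the renders).  p. 27: "Let us recall that if we apply a gauge transformation v to a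
configuration V, V^v_b = v(b₋)V_bv⁻¹(b₊), b ⊂ Ω′, then (\overline{V^v})_c = v(c₋)V̄_cv⁻¹(c₊), c ⊂ Ω′^{(1)}. We will consider
gauge field configurations V of the form V = V′V₀, where V₀ is a fixed configuration and V′ may have values in the
complexified group G^c. We find easily that if we apply a gauge transformation v to V and we write V^v = V′^vV₀, then
V′^v_b = v(b₋)V′_bR(V_{0,b})v⁻¹(b₊) = v(b₋)V′_bR_{0,b}v⁻¹(b₊), (55) where for arbitrary invertible matrix X the operator R(X)
is given by the formula R(X)Y = XYX⁻¹. (56) R(X) acts on the algebra of all matrices and has the following properties: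
R(X)f(Y) = f(R(X)Y) for analytic functions f, R(X)R(Y) = R(XY), R(X)⁻¹ = R(X⁻¹), R(X)* = R(X*). (57) In a one-step
renormalization transformation we consider configurations V′ satisfying axial gauge conditions in blocks:
(R_{0,y}V′)(Γ_{y,x}) = ∏_{b⊂Γ_{y,x}} R(V₀(Γ_{y,b₋}))V′_b = 1, x ∈ B(y), x ≠ y. (58) It will be convenient to change this
gauge into another one. We apply a gauge transformation v⁻¹ to V′ and we get a configuration V₁, thus V′ = V₁^v and
V̄_c = (\overline{V′V₀})_c = (\overline{V₁^vV₀})_c = v(c)(\overline{V₁V₀})_cv⁻¹(c₊). We will consider this average for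
configurations V′ and V₁ with values close to 1 and we will be interested in the expression
V̄_c(V̄₀)_c⁻¹ = v(c₋)(\overline{V₁V₀})_c(V̄₀)_c⁻¹R̄_{0,c}v⁻¹(c₊), R̄_{0,c} = R((V̄₀)_c). (59) The gauge conditions (58) written
in terms of the configurations V₁ and v have the form (R_{0,y}V′)(Γ_{y,x}) = v(y)(R_{0,y}V₁)(Γ_{y,x})(R_{0,y}v)⁻¹(x) = 1,
(R_{0,y}v)(x) = R(V₀(Γ_{y,x}))v(x), and they imply (R_{0,y}v)(x) = v(y)(R_{0,y}V₁)(Γ_{y,x}), x ∈ B(y), x ≠ y,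
y ∈ Ω′^{(1)}. (60)"  p. 28: "v(y) = exp[−iΣ_{x∈B(y)}L^{−d}(1/i) log(R_{0,y}V₁)(Γ_{y,x})]" (62).  p. 29: "(Ũ′)_c =
(\overline{U′U₀})_c(Ū₀)_c⁻¹" (65) [no domain clause in print; `c` runs over the `L`-bonds, cf. (42)]; "Ũ′^{j+1}_c =
(\overline{Ũ′^jŪ₀^j})_c(\overline{Ū₀^j})_c⁻¹" (68); "Ũ′^j_b = (\overline{U′U₀})^j_b(Ū₀^j)_b⁻¹, b ⊂ Ω^{(j)}" (69); "Ū^j_b =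
(\overline{U₁^uU₀})^j_b = u(b₋)(\overline{U₁U₀})^j_bu⁻¹(b₊), b ⊂ Ω^{(j)}" (70); "Ũ′^j_b = (Ũ₁^u)^j_b = u(b₋)(Ũ₁)^j_bR̄^j_{0,b}u⁻¹(b₊),
b ⊂ Ω^{(j)}" (71) [(65), (69)–(71) re-read on the render p013 for v1.0.1].  p. 30: "Generally a one-step averaging
transformation defined by a field configuration V₀ is given by (R̄₀v)(y) = (\overline{R(V₀)v})(y) = {(R(V₀)v)(x)}_{x∈B(y)}
= v(y)exp[iΣ_{x∈B(y)}L^{−d}(1/i) log v⁻¹(y)R(V₀(Γ_{y,x}))v(x)], (78)";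
"(R̄₀u)(x₁) = u(x₁)(\overline{R_{0,x₁}U₁})(Γ_{x₁,·}) = u(x₁)\overline{R_{0,x₁}U₁} (82) for x₁ ∈ Ω^{(1)}, where the expression
\overline{R_{0,x₁}U₁} is defined by the last equation."  p. 31: "Now we will prove the following fundamental fact: the new
k^{th} order averaging operation defined by the last expression in (88) is a composition of k averaging operations
defined by (63) with properly chosen configurations V₀. More precisely, for a j^{th} factor in this composition, we take
V₀ = Ū₀^{j−1}. Let us introduce some new notations. We denote the averaging operation in (63) by
(\overline{\overline{R(V₀)V₁}})_c = (\overline{R_{0,c₋}V₁})⁻¹(\overline{V₁V₀})_c(V̄₀)_c⁻¹R̄_{0,c}\overline{R_{0,c₊}V₁} =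
(\overline{R_{0,c₋}V₁})⁻¹Ṽ₁R̄_{0,c}\overline{R_{0,c₊}V₁}. (89) We define inductively a sequence of averaging operations of
j^{th} order composing j operations defined above for V₀ = U₀, Ū₀, …, Ū₀^{j−1} correspondingly. For j = 1 we define
U̿₁ = \overline{\overline{R(U₀)U₁}}, (90) and if the operation U̿₁^j is defined, then U̿₁^{j+1} = \overline{\overline{R(Ū₀^j)U̿₁^j}},
(91) i.e., it is a composition of the operation (89) for V₀ = Ū₀^j and of the j^{th} order operation U̿₁^j. […] We are
going to prove now the fundamental equality (\overline{R_{0,b₋}U₁^{(k)}})⁻¹Ũ₁^kR̄^k_{0,b}\overline{R_{0,b₊}U₁^{(k)}} = (U̿₁^k)_b.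
(92) The proof will be by induction. For k = 1 the equality holds by the definitions (89), (90), and the Eq. (63)."
p. 32: "for an arbitrary gauge transformation v we write V = (V^{v⁻¹})^v = (V₁^{v⁻¹}V₀)^v and we have (Ṽ₁)_c =
(\overline{V₁V₀})_cV̄_{0,−c} = v(c₋)(\widetilde{V₁^{v⁻¹}})_cR̄_{0,c}v⁻¹(c₊), c ⊂ Ω′^{(1)}. (93)"; "(\widetilde{U₁^{v⁻¹}})_b =
(\overline{R_{0,b₋}U₁})⁻¹Ũ_{1,b}R̄_{0,b}\overline{R_{0,b₊}U₁} = U̿₁, (95)"; "Let us make the following inductive hypothesis: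
(Ũ₁^j)_b = v_j(b₋)(U̿₁^j)_bR̄^j_{0,b}v_j⁻¹(b₊) = (U̿₁^j)^{v_j}_b, b ⊂ Ω^{(j)}, v_j(x) =
(\overline{R_{0,x}U₁})(\overline{R̄_{0,x}U̿₁})·…·(\overline{R̄^{j−1}_{0,x}U̿₁^{j−1}}), x ∈ Ω^{(j)}. (97) We have proved it for
j = 1, 2. The definition (68) and the hypothesis imply (Ũ₁^{j+1})_c = … = v_{j+1}(c₋)(U̿₁^{j+1})_cR̄^{j+1}_{0,c}v_{j+1}⁻¹(c₊),
(98) where we have used the identity (93) again and the other definitions."; "\overline{R_{0,x}U₁^{(j)}} = v_j(x),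
x ∈ Ω^{(j)}. (99) […] From (97), (99) for j = k we get (92)."  p. 31 (88): "Ū^k_b(Ū₀^k)_b⁻¹ = (\overline{U′U₀^k})_b(Ū₀^k)_b⁻¹
= …", p. 42 (159): "Ū^k_b(Ū^k_0)_b⁻¹ = (\overline{U′U₀})^k_b(Ū^k_0)_b⁻¹ = (Ũ′)^k_b = v_k(b₋)(U̿′^k)_bR̄^k_{0,b}v_k⁻¹(b₊),
b ⊂ Ω^{(k)}", (160) "v_k(x) = (\overline{R_{0,x}U′})(\overline{R̄_{0,x}U̿′})·…·(\overline{R̄^{k−1}_{0,x}U̿′^{k−1}}), x ∈ Ω^{(k)}".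

DICTIONARY print ↦ Lean (conventions of the lineage: `B7Prop1Explicit`/`B7Prop2Explicit`/`B7Prop3Flat`).  Group of bond
values: the units `𝔸ˣ` of a complete normed `ℂ`-algebra `𝔸` (print: `G^c`, "arbitrary invertible matrix X"); §1 is over an
arbitrary group `G`.  Every lattice `Ω^{(j)}` is identified with `ℤ^d` (`Site d`) by `rescale` (`Ω^{(j+1)} ∋ x = Lz ↤ z`);
a bond `b = ⟨x, x + e_κ⟩` of the unit lattice is the pair `(x, κ)`, an `L`-bond `c = ⟨q, q + Le_κ⟩` (before rescaling) the
pair `(q, κ)`; the block `B(y) = y + [0, L)^d` (`boxVec`), the tree contour `Γ_{y,x}` = `treeWord (x − y)` from `y`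
(positively oriented bonds).  "V = V′V₀" ↦ the bondwise product `V₁ * V₀` of `Site d → Fin d → 𝔸ˣ`.  (56) `R(X)` ↦
`Rc X : 𝔸ˣ →* 𝔸ˣ`; (55) `V′ ↦ V′^v` relative to `V₀` ↦ `mgauge V₀ v V′`; (58) `(R_{0,y}V′)(Γ)` ↦ `tHol V₀ V′ y Γ`, DEFINED as
the telescoped form `(V′V₀)(Γ)·V₀(Γ)⁻¹` and PROVED equal to the printed ordered product bond by bond (`tHol_append_true`);
the block frame `\overline{R_{0,y}V₁}` of (82) (= `exp[Σ_{x∈B(y)} L^{−d} log (R_{0,y}V₁)(Γ_{y,x})]` by (78) with `u(y)` factored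
as in (82), the `i·(1/i)` cancelled; (62) is its inverse) ↦ `wframe L V₀ V₁ y = expUnit (Fcov L V₀ V₁ y)`; `log` = the
series (21) `mlog` throughout (as in the whole lineage); (65) `Ṽ₁` ↦ `tild L V₀ V₁`; (89) ↦ `dbavgCov L V₀ V₁`, with
`R̄_{0,c} = R((V̄₀)_c)` ↦ `Rc (bavg L V₀ q κ)`; (69) `Ũ₁^j` ↦ `tildIter L U₀ U₁ j`; (90)/(91) `U̿₁^j` ↦ `dbavgCovIter L U₀ U₁ j`
(background of the `j`-th step `Ū₀^j = avgIter L U₀ j`); (97)/(160) `v_j` ↦ `vcov L U₀ U₁ j` (recursively `v_0 = 1`,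
`v_{j+1}(z) = v_j(Lz)·\overline{R̄^j_{0,Lz}U̿₁^j}`, the new factor `wframe L (avgIter L U₀ j) (dbavgCovIter L U₀ U₁ j) (Lz)` on
the RIGHT as printed); a gauge function `u` of the original lattice read at level `j`, `u_j(z) = u(L^jz)` ↦ `uLev L u j`.

WHAT THIS FILE PROVES (kernel, no `sorry`, standard axioms; NO hypotheses anywhere — every statement holds for all `d`,
`L`, `j`, all unit-valued configurations and all unit-valued site functions):
* §1 (group `G`): `Rc_mul`, `Rc_inv_apply` — (57) `R(X)R(Y) = R(XY)`, `R(X)⁻¹ = R(X⁻¹)`; `mgauge_mul` — p. 27 "V^v = V′^vV₀":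
  `(V′^v)·V₀ = (V′V₀)^v` with `(·)^v` the gauge action (8); `tHol_append_true` — (58): the telescoped `(V′V₀)(Γ)V₀(Γ)⁻¹` obeys
  the printed product rule `… · R(V₀(Γ_{y,b₋}))V′_b` for each appended positively oriented bond (`tHol_append_false`: the
  rule forced by (9) for a reversed bond); `tHol_mgauge` — the display after (59): `(R_{0,y}V₁^v)(Γ_{y,x}) =
  v(y)(R_{0,y}V₁)(Γ_{y,x})[R(V₀(Γ_{y,x}))v(x)]⁻¹`; `tHol_one_left` — at `V₀ = 1`, `(R_{0,y}V₁)(Γ) = V₁(Γ)` (p. 34).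
* §2 (one step, `𝔸ˣ`): `mlog_Rc`, `expUnit_conj` — (57) `R(X)f(Y) = f(R(X)Y)` for `f = log` (the series (21), NO condition)
  and `f = exp`; `tild_mgauge` — (59) = (93), the covariance `\widetilde{W^v}(c) = v(c₋)W̃(c)R̄_{0,c}v⁻¹(c₊)` for EVERY
  invertible `v`; `tild_eq_frame_dbavgCov` / `rescale_tild_eq_mgauge` — (89) solved, i.e. (92) at `k = 1`:
  `Ṽ₁ = (V̿₁)^{w}`, `w = \overline{R_{0,·}V₁}`; `tild_mgauge_inv_wframe` — (95) `\widetilde{V₁^{w⁻¹}} = V̿₁`; the flat reductions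
  (via `B8Ineq130.hol_one`/`bavg_one`, `1̄ = 1`, REUSED BY NAME) `Fcov_one_left`, `wframe_one_left`, `tild_one_left` ((120)
  `Ṽ₁ = V̄₁`), `dbavgCov_one_left`; and the
  dictionary to the abstract skeleton: `frame_eq_mgauge`, `dbar_eq_dbavgCov`, `hcov_concrete` (the binder `hcov` of
  `B7Transfer.step98` holds for B7's average).
* §3 (`k` steps): `tildIter_succ` — (68); `tildIter_mul` — (69) as `Ũ₁^jŪ₀^j = (\overline{U₁U₀})^j`; `tildIter_eq_mgauge` —
  THE FUNDAMENTAL EQUALITY (97) (hence (92) given (99)) `Ũ₁^j = (U̿₁^j)^{v_j}` for every `j`, by print's induction (98)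
  (ingredients: (68), (93), (89) and `R̄` a homomorphism — nothing else); `avgIter_mul_eq_gaugeAct` / `val_avgIter_mul_eq` —
  (88)/(159) at an arbitrary background: `(\overline{U₁U₀})^k = (U̿₁^k·Ū₀^k)^{v_k}`, bondwise
  `Ū^k(c) = v_k(c₋)·U̿₁^k(c)·Ū₀^k(c)·v_k(c₊)⁻¹`; `tildIter_mgauge` — (70)/(71); the flat reductions `avgIter_one`,
  `dbavgCovIter_one_left` (= `dbavgIter`), `vcov_one_left` (= `vprod`), `tildIter_one_left`, and
  `avgIter_eq_gaugeAct_vprod'` — (159) at `U₀ = 1` re-derived (consistency with `B7Prop6Flat`).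

ABSOLUTE-RULE LEDGER.  No hypotheses at all; no `B7.Prop*` placeholder, no Literature `Prop`-fact, nothing of the
manuscript cited as a fact.  All objects are concrete definitions over the tree's `hol`/`bavg`/`avgIter`.

NOT CERTIFIED HERE (located).  (i) (99)–(100): the identification of the product frame `v_j` (97) with the recursively
defined block averages `\overline{R_{0,x}U₁^{(j)}}` (85) — `vcov` is (97) read directly (as `B7Prop6Flat.vprod` is (160));
the abstract form is `B7Transfer.step99`, whose left-invariance binder `hb` for the site average (78) is not discharged
here.  (ii) Sect. B's gauge fixing: the axial conditions (58) "= 1", the averaging conditions (61)/(81), the solution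
(62)/(84)/(87) for the gauge transformation `u`, and (63)/(88) as statements about the gauge-fixed field — the frames
are DEFINED by (82) and only the algebra (89) ⇒ (92)/(97) is proved.  (iii) The locality remark p. 31.  (iv) Every
ESTIMATE: Props. 3–6 at a curved background (`B7.Prop3Printed` … `B7.Prop6Printed`), Prop. 7; this file supplies their
objects, not their bounds.  (v) (57) `R(X)* = R(X*)` (no involution is assumed on `𝔸`).

DIVERGENCES from print (cell DIVERGENCE.md D-b07g19.4).  (a) SETTING: `ℤ^d` for every `Ω^{(j)}` (rescaling dictionary),
bond values in the units of a complete normed `ℂ`-algebra, frames ANY unit-valued site functions — print's `v`, `v_j` are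
`G^c`-valued and (11)/(93) are used for them without comment; here (11) for invertible non-unitary gauge functions is the
kernel theorem `B7Prop6Flat.bavg_gaugeAct_units` (series logarithm (21), conjugation acting termwise, D-b07g19.1 (b)).
(b) (58) is DEFINED by its telescoped form and the printed product is a THEOREM (for the positively oriented tree
contours the two agree bond by bond; for reversed bonds the convention (9) is applied to `V′V₀` and `V₀`).  (c) The block
frame is DEFINED by (82)/(78) as `exp` of the `L^{−d}`-weighted sum of series logarithms, at EVERY site of the fine lattice
(print: at the sites of `Ω^{(1)}`; the extension is immaterial, cf. (95)/`tild_mgauge_inv_wframe`), with no domain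
condition (off the convergence set of (21) the objects are junk values and the identities still hold).  (d) `log` is the
series (21), not the spectral logarithm (22) (lineage convention).

FINDINGS (cell GAPS.md C-b07g19-2).  The algebra of Sects. B–C leading to the fundamental equality (92)/(97) is correct
as printed and holds as a formal identity with NO smallness and NO unitarity, for B7's own average: the only inputs are
the definitions (65), (68), (89)–(91), (97), the gauge covariance of the average (42) under arbitrary invertible gauge
functions, and `R̄` being a homomorphism — exactly the hypothesis list of the abstract `B7Transfer.step98`, now
discharged for the concrete average.  No gap located.  VALUE = the paper's own covariant objects at an arbitrary
background, kernel-defined and with their structural identities certified — the entry point for the curved-background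
Props. 3–7 (whose printed leaves `B7.Prop3Printed`–`B7.Prop6Printed` remain undischarged); NOT summit progress.

VERSIONS.  v1 (gen 19, p190677, commit 88e3dbd1a3cf): this file.  v1.0.1 (gen 19): DOCSTRING-ONLY quotation hygiene after
the FULL cross-read of pv04-g19 (journal l.56669, verdict ok CONSISTENT, ABSOLUTE-RULE 0, kernel 0, DOCFIX 2 LOW): D1 the quotation
of (65) carried a domain clause "c ∈ Ω′^{(1)}" that print does not have — dropped (header and `tild`); D2 the quotations of
(70)/(71) silently elided the middle members "(\overline{U₁^uU₀})^j_b =" / "(Ũ₁^u)^j_b =" and the clause "b ⊂ Ω^{(j)}" — inserted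
(header and `tildIter_mgauge`); (69)'s clause "b ⊂ Ω^{(j)}" added likewise.  No declaration, statement or proof changed.
-/

noncomputable section

open scoped BigOperators
open NormedSpace Finset

namespace Literature.MathematicalPhysics.QuantumFieldTheory.Balaban1983to89.B7Eq92Concrete

open B7Prop1Explicit B7Prop2Explicit B7Prop3Flat B7Prop4Flat MatrixLog B7AvgGaugeCovariance B7Prop6Flat
open B8Ineq130 (hol_one bavg_one)

-- `Site` alone would resolve to the torus sites of `Setup.lean`; re-export the `ℤ^d` sites of `B7Prop1Explicit`.
export B7Prop1Explicit (Site)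

variable {d : ℕ}

/-! ## §1 Group algebra: the rotations (56)–(57), the moving-frame action (55), the twisted holonomy (58) -/

section GroupAlgebra

variable {G : Type*} [Group G]

/-- **(56)** "R(X)Y = XYX⁻¹": the rotation by `X`, as a group endomorphism of `G` (print: "linear transformations R(X)
... transformations in the algebra of all complex matrices N × N"; here on the group of units, which is all that
Sects. B–C use). [cite: Balaban1985Averaging, (56) p.27] -/
def Rc (X : G) : G →* G where
  toFun Y := X * Y * X⁻¹
  map_one' := by group
  map_mul' Y Z := by group

/-- `Rc_apply`: (56) unfolded. [cite: Balaban1985Averaging, (56) p.27] -/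
@[simp] theorem Rc_apply (X Y : G) : Rc X Y = X * Y * X⁻¹ := rfl

/-- **(57)** "R(X)R(Y) = R(XY)". [cite: Balaban1985Averaging, (57) p.27] -/
theorem Rc_mul (X Y : G) : Rc (X * Y) = (Rc X).comp (Rc Y) := by
  ext Z; simp only [Rc_apply, MonoidHom.coe_comp, Function.comp_apply]; group

/-- **(57)** "R(X)⁻¹ = R(X⁻¹)": `R(X⁻¹)` is a two-sided inverse of `R(X)`. [cite: Balaban1985Averaging, (57) p.27] -/
theorem Rc_inv_apply (X Y : G) : Rc X⁻¹ (Rc X Y) = Y ∧ Rc X (Rc X⁻¹ Y) = Y := by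
  constructor <;> (simp only [Rc_apply]; group)

/-- `Rc_one`: `R(1) = id`. [cite: Balaban1985Averaging, (56) p.27] -/
@[simp] theorem Rc_one_apply (Y : G) : Rc (1 : G) Y = Y := by simp

/-- **(55)** p. 27, the MOVING-FRAME gauge action relative to a background `V₀`: "V′^v_b = v(b₋)V′_b R(V_{0,b})v⁻¹(b₊) =
v(b₋)V′_b R_{0,b}v⁻¹(b₊)" (`b = ⟨x, x + e_κ⟩`; `R_{0,b} = R(V_{0,b})`). [cite: Balaban1985Averaging, (55) p.27] -/
def mgauge (V₀ : Site d → Fin d → G) (v : Site d → G) (V₁ : Site d → Fin d → G) : Site d → Fin d → G :=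
  fun x κ => v x * V₁ x κ * (Rc (V₀ x κ) (v (x + e κ)))⁻¹

/-- `mgauge_apply`: (55) unfolded. [cite: Balaban1985Averaging, (55) p.27] -/
@[simp] theorem mgauge_apply (V₀ : Site d → Fin d → G) (v : Site d → G) (V₁ : Site d → Fin d → G) (x : Site d)
    (κ : Fin d) : mgauge V₀ v V₁ x κ = v x * V₁ x κ * (Rc (V₀ x κ) (v (x + e κ)))⁻¹ := rfl

/-- **Why (55) is the right action** (p. 27: "if we write V = V′V₀, then V^v = V′^vV₀"): the moving-frame transform of `V′`
times the background is the ORDINARY gauge transform (8) of the product, `(V′^v)V₀ = (V′V₀)^v` bondwise.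
[cite: Balaban1985Averaging, (55) p.27, (8) p.18] -/
theorem mgauge_mul (V₀ : Site d → Fin d → G) (v : Site d → G) (V₁ : Site d → Fin d → G) :
    mgauge V₀ v V₁ * V₀ = gaugeAct v (V₁ * V₀) := by
  funext x κ
  simp only [Pi.mul_apply, mgauge_apply, gaugeAct, Rc_apply]
  group

/-- At the flat background the moving-frame action is the gauge action (8). [cite: Balaban1985Averaging, (55) p.27, (8) p.18] -/
@[simp] theorem mgauge_one_left (v : Site d → G) (V₁ : Site d → Fin d → G) :
    mgauge (1 : Site d → Fin d → G) v V₁ = gaugeAct v V₁ := by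
  funext x κ
  simp [gaugeAct]

/-- **(58)** p. 27, the `R₀`-TWISTED parallel transport `(R_{0,y}V′)(Γ)` of `V′` along a contour `Γ` from `y`, relative
to the background `V₀` — here DEFINED through the telescoped form `(R_{0,y}V′)(Γ) = (V′V₀)(Γ)·V₀(Γ)⁻¹` (the product
`V = V′V₀` transported, then the background transport removed); `tHol_append_true` below proves that this IS the printed
ordered product "(R_{0,y}V′)(Γ_{y,x}) = ∏_{b⊂Γ_{y,x}} R(V₀(Γ_{y,b₋}))V′_b" for contours of positively oriented bonds (the
tree contours `Γ_{y,x}`, `x ∈ B(y)`, are such). [cite: Balaban1985Averaging, (58) p.27, (9) p.18] -/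
def tHol (V₀ V₁ : Site d → Fin d → G) (y : Site d) (w : List (Letter d)) : G :=
  hol (V₁ * V₀) y w * (hol V₀ y w)⁻¹

/-- `tHol_nil`: the empty contour. [cite: Balaban1985Averaging, (58) p.27] -/
@[simp] theorem tHol_nil (V₀ V₁ : Site d → Fin d → G) (y : Site d) : tHol V₀ V₁ y [] = 1 := by simp [tHol]

/-- **(58) verbatim, one bond at a time**: appending the positively oriented bond `b = ⟨x, x + e_μ⟩`, `x = y + disp Γ`, to
`Γ` multiplies `(R_{0,y}V′)(Γ)` on the right by `R(V₀(Γ_{y,b₋}))V′_b = V₀(Γ) V′_b V₀(Γ)⁻¹` — so for a contour of positively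
oriented bonds `(R_{0,y}V′)(Γ) = ∏_{b⊂Γ} R(V₀(Γ_{y,b₋}))V′_b` in the order of `Γ`. [cite: Balaban1985Averaging, (58) p.27] -/
theorem tHol_append_true (V₀ V₁ : Site d → Fin d → G) (y : Site d) (w : List (Letter d)) (μ : Fin d) :
    tHol V₀ V₁ y (w ++ [(μ, true)]) = tHol V₀ V₁ y w * Rc (hol V₀ y w) (V₁ (y + disp w) μ) := by
  simp only [tHol, hol_append, hol_cons, hol_nil, stepHol_true, Pi.mul_apply, Rc_apply, mul_one]
  group

/-- The same recursion for a NEGATIVELY oriented bond `−b`, `b = ⟨x − e_μ, x⟩` (convention (9) `U(−b) = U(b)⁻¹` applied to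
the product `V′V₀` and to `V₀`): the new factor is `R(V₀(Γ ∪ (−b)))(V′_b⁻¹)`, the rotation now by the background transport
INCLUDING the reversed bond. (Print states (58) for the tree contours only; this is the reading forced by (9).)
[cite: Balaban1985Averaging, (58) p.27, (9) p.18] -/
theorem tHol_append_false (V₀ V₁ : Site d → Fin d → G) (y : Site d) (w : List (Letter d)) (μ : Fin d) :
    tHol V₀ V₁ y (w ++ [(μ, false)])
      = tHol V₀ V₁ y w * Rc (hol V₀ y (w ++ [(μ, false)])) (V₁ (y + disp w - e μ) μ)⁻¹ := by
  simp only [tHol, hol_append, hol_cons, hol_nil, stepHol_false, Pi.mul_apply, Rc_apply, mul_one, mul_inv_rev]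
  group

/-- **p. 27, the display between (59) and (60), for EVERY `G`-valued `v`**: "The gauge conditions (58) written in terms of
the configurations V₁ and v have the form (R_{0,y}V′)(Γ_{y,x}) = v(y)(R_{0,y}V₁)(Γ_{y,x})(R_{0,y}v)⁻¹(x) = 1,
(R_{0,y}v)(x) = R(V₀(Γ_{y,x}))v(x)" with `V′ = V₁^v` — i.e. the twisted transport is covariant under the moving-frame action,
`(R_{0,y}V₁^v)(Γ) = v(y)·(R_{0,y}V₁)(Γ)·[R(V₀(Γ))v(Γ₊)]⁻¹` (the `= 1` is the axial gauge CONDITION on `V′`, not asserted here).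
This is the transporter covariance `hT` of the abstract `B7Transfer.step99`, for B7's own transport.
[cite: Balaban1985Averaging, (58)–(60) p.27, (8) p.18] -/
theorem tHol_mgauge (V₀ V₁ : Site d → Fin d → G) (v : Site d → G) (y : Site d) (w : List (Letter d)) :
    tHol V₀ (mgauge V₀ v V₁) y w = v y * tHol V₀ V₁ y w * (Rc (hol V₀ y w) (v (y + disp w)))⁻¹ := by
  simp only [tHol, mgauge_mul, hol_gaugeAct, Rc_apply]
  group

/-- At the flat background the twisted transport is the transport (9): `(R_{0,y}V′)(Γ) = V′(Γ)` for `V₀ = 1` (p. 34, (110):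
"(R_{0,y}V₁)(Γ_{y,x}) = V₁(Γ_{y,x})" there). [cite: Balaban1985Averaging, (58) p.27, (110) p.34] -/
@[simp] theorem tHol_one_left (V₁ : Site d → Fin d → G) (y : Site d) (w : List (Letter d)) :
    tHol (1 : Site d → Fin d → G) V₁ y w = hol V₁ y w := by
  simp [tHol, hol_one]

end GroupAlgebra

/-! ## §2 The concrete one-step objects at an arbitrary background `V₀`: the block frame (82)/(62), the average `Ṽ₁` (65),
the double-bar average (89); the covariance (93) for ALL invertible frames; (89) solved = (92) at `k = 1` -/

section OneStep

variable {𝔸 : Type*} [NormedRing 𝔸] [NormedAlgebra ℂ 𝔸] [CompleteSpace 𝔸]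

omit [CompleteSpace 𝔸] in
/-- **(57)** "R(X)f(Y) = f(R(X)Y)" for `f = log`, the series (21), with NO condition on `X`, `Y`
(`B7Prop6Flat.mlog_conj`). [cite: Balaban1985Averaging, (57) p.27, (21) p.21] -/
theorem mlog_Rc (X Y : 𝔸ˣ) : mlog ((Rc X Y : 𝔸ˣ) : 𝔸) = (X : 𝔸) * mlog (Y : 𝔸) * ((X⁻¹ : 𝔸ˣ) : 𝔸) := by
  rw [Rc_apply, Units.val_mul, Units.val_mul, mlog_conj]

/-- **(57)** "R(X)f(Y) = f(R(X)Y)" for `f = exp`: `exp(X A X⁻¹) = R(X) exp A`. [cite: Balaban1985Averaging, (57) p.27] -/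
theorem expUnit_conj (X : 𝔸ˣ) (A : 𝔸) : expUnit ((X : 𝔸) * A * ((X⁻¹ : 𝔸ˣ) : 𝔸)) = Rc X (expUnit A) := by
  letI : NormedAlgebra ℚ 𝔸 := NormedAlgebra.restrictScalars ℚ ℂ 𝔸
  apply Units.ext
  simp only [val_expUnit, Rc_apply, Units.val_mul, exp_units_conj]

/-- **The exponent of the block frame (82)/(62) at the background `V₀`**: `F(y) := Σ_{x∈B(y)} L^{−d} log (R_{0,y}V₁)(Γ_{y,x})`
(`y = q`, `x = q + r`, `r ∈ [0, L)^d`, `Γ_{y,x}` the tree contour `treeWord r` from `q`; `log` = the series (21)). Print, (62)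
p. 28: "v(y) = exp[−iΣ_{x∈B(y)}L^{−d}(1/i) log(R_{0,y}V₁)(Γ_{y,x})]" (the gauge-fixing transformation, `= F`-frame⁻¹) and (82)
p. 30: "(R̄₀u)(x₁) = u(x₁)(\overline{R_{0,x₁}U₁})(Γ_{x₁,·}) = u(x₁)\overline{R_{0,x₁}U₁} ... where the expression
\overline{R_{0,x₁}U₁} is defined by the last equation", the bar being the site average (78)
"(R̄₀v)(y) = v(y)exp[iΣ_{x∈B(y)}L^{−d}(1/i) log v⁻¹(y)R(V₀(Γ_{y,x}))v(x)]". At `V₀ = 1` this is `B7Prop3Flat.Favg`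
(`Fcov_one_left`). [cite: Balaban1985Averaging, (62) p.28, (78) p.30, (82) p.30, (110) p.34] -/
def Fcov (L : ℕ) (V₀ V₁ : Site d → Fin d → 𝔸ˣ) (y : Site d) : 𝔸 :=
  ∑ r : Fin d → Fin L, (((L : ℝ) ^ d)⁻¹) • mlog ((tHol V₀ V₁ y (treeWord (boxVec L r)) : 𝔸ˣ) : 𝔸)

/-- **The block frame `\overline{R_{0,y}V₁} = exp F(y)`** ((82) p. 30 / (62) p. 28 / (85) p. 31 at `j = 0`), a unit of `𝔸`;
at `V₀ = 1` it is `B7Prop3Flat.vframe` (`wframe_one_left`). [cite: Balaban1985Averaging, (82) p.30, (62) p.28, (85) p.31] -/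
def wframe (L : ℕ) (V₀ V₁ : Site d → Fin d → 𝔸ˣ) (y : Site d) : 𝔸ˣ := expUnit (Fcov L V₀ V₁ y)

/-- **(65)** p. 29: "(Ũ′)_c = (\overline{U′U₀})_c(Ū₀)_c⁻¹" (no domain clause in print) — the one-step average (42) of the product
`V₁V₀` with the averaged background removed, on the `L`-bonds `c = ⟨q, q + Le_κ⟩` (indexed by `(q, κ)` as `bavg`).
[cite: Balaban1985Averaging, (65) p.29, (42) p.23] -/
def tild (L : ℕ) (V₀ V₁ : Site d → Fin d → 𝔸ˣ) : Site d → Fin d → 𝔸ˣ :=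
  fun q κ => bavg L (V₁ * V₀) q κ * (bavg L V₀ q κ)⁻¹

/-- **(89)** p. 31, the one-step DOUBLE-BAR average at the background `V₀`:
"(\overline{\overline{R(V₀)V₁}})_c = (\overline{R_{0,c₋}V₁})⁻¹(\overline{V₁V₀})_c(V̄₀)_c⁻¹R̄_{0,c}\overline{R_{0,c₊}V₁}
= (\overline{R_{0,c₋}V₁})⁻¹Ṽ₁R̄_{0,c}\overline{R_{0,c₊}V₁}", `R̄_{0,c} = R((V̄₀)_c)` ((59) p. 27), `c = ⟨q, q + Le_κ⟩`.
At `V₀ = 1` it is `B7Prop3Flat.dbavg` (`dbavgCov_one_left`); it is the instance of the abstract recipe `B7Transfer.dbar`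
(`dbar_eq_dbavgCov`). [cite: Balaban1985Averaging, (89) p.31, (59) p.27] -/
def dbavgCov (L : ℕ) (V₀ V₁ : Site d → Fin d → 𝔸ˣ) : Site d → Fin d → 𝔸ˣ :=
  fun q κ => (wframe L V₀ V₁ q)⁻¹ * tild L V₀ V₁ q κ * Rc (bavg L V₀ q κ) (wframe L V₀ V₁ (q + (L : ℤ) • e κ))

/-- `tild_apply`: (65) unfolded. [cite: Balaban1985Averaging, (65) p.29] -/
@[simp] theorem tild_apply (L : ℕ) (V₀ V₁ : Site d → Fin d → 𝔸ˣ) (q : Site d) (κ : Fin d) :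
    tild L V₀ V₁ q κ = bavg L (V₁ * V₀) q κ * (bavg L V₀ q κ)⁻¹ := rfl

/-- `dbavgCov_apply`: (89) unfolded. [cite: Balaban1985Averaging, (89) p.31] -/
theorem dbavgCov_apply (L : ℕ) (V₀ V₁ : Site d → Fin d → 𝔸ˣ) (q : Site d) (κ : Fin d) :
    dbavgCov L V₀ V₁ q κ
      = (wframe L V₀ V₁ q)⁻¹ * tild L V₀ V₁ q κ * Rc (bavg L V₀ q κ) (wframe L V₀ V₁ (q + (L : ℤ) • e κ)) := rfl

/-- **(59) p. 27 = (93) p. 32 — THE COVARIANCE OF THE ONE-STEP OPERATION `V₁ ↦ Ṽ₁` UNDER MOVING FRAMES, for EVERY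
invertible frame `v`** (no unitarity, no smallness: the frames `v_j` of (97)/(160) are complex; print p. 27: "V′ may have
values in the complexified group G^c", "for arbitrary invertible matrix X").  (59): "V̄_c(V̄₀)_c⁻¹ =
v(c₋)(\overline{V₁V₀})_c(V̄₀)_c⁻¹R̄_{0,c}v⁻¹(c₊), R̄_{0,c} = R((V̄₀)_c)" for `V = V′V₀`, `V′ = V₁^v`; (93): "for an arbitrary gauge
transformation v we write V = (V^{v⁻¹})^v = (V₁^{v⁻¹}V₀)^v and we have (Ṽ₁)_c = (\overline{V₁V₀})_cV̄_{0,−c} =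
v(c₋)(\widetilde{V₁^{v⁻¹}})_cR̄_{0,c}v⁻¹(c₊), c ⊂ Ω′^{(1)}" — both say `\widetilde{W^{v}}(c) = v(c₋)·W̃(c)·R̄_{0,c}v⁻¹(c₊)`
(`W = V₁`, resp. `W = V₁^{v⁻¹}`).  Proof = print's (p. 27 "V̄_c = (\overline{V′V₀})_c = (\overline{V₁^vV₀})_c =
v(c)(\overline{V₁V₀})_cv⁻¹(c₊)"): `(V₁^v)V₀ = (V₁V₀)^v` (`mgauge_mul`) and the covariance of the average (42), p. 27 first
sentence "(\overline{V^v})_c = v(c₋)V̄_cv⁻¹(c₊)" / p. 24 sentence after (43) (cell label (45)/(11)), valid for ARBITRARY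
invertible gauge functions (`B7Prop6Flat.bavg_gaugeAct_units`).  This is the hypothesis `hcov` of the abstract
`B7Transfer.step98`, DISCHARGED for B7's own average (`hcov_concrete`). [cite: Balaban1985Averaging, (59) p.27, (93) p.32, p.24, (11) p.19] -/
theorem tild_mgauge (L : ℕ) (V₀ V₁ : Site d → Fin d → 𝔸ˣ) (v : Site d → 𝔸ˣ) (q : Site d) (κ : Fin d) :
    tild L V₀ (mgauge V₀ v V₁) q κ
      = v q * tild L V₀ V₁ q κ * (Rc (bavg L V₀ q κ) (v (q + (L : ℤ) • e κ)))⁻¹ := by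
  simp only [tild_apply, mgauge_mul, bavg_gaugeAct_units, Rc_apply]
  group

/-- **(89) solved for `Ṽ₁` = the fundamental equality (92) at `k = 1`** (p. 31: "For k = 1 the equality holds by the
definitions (89), (90), and the Eq. (63)"): `Ṽ₁(c) = w(c₋)·V̿₁(c)·R̄_{0,c}w(c₊)⁻¹`, `w = \overline{R_{0,·}V₁}` — group algebra,
no property of the average used (abstractly `B7Transfer.avg_eq_frame_dbar`). [cite: Balaban1985Averaging, (92) p.31, (89) p.31] -/
theorem tild_eq_frame_dbavgCov (L : ℕ) (V₀ V₁ : Site d → Fin d → 𝔸ˣ) (q : Site d) (κ : Fin d) :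
    tild L V₀ V₁ q κ
      = wframe L V₀ V₁ q * dbavgCov L V₀ V₁ q κ
          * (Rc (bavg L V₀ q κ) (wframe L V₀ V₁ (q + (L : ℤ) • e κ)))⁻¹ := by
  simp only [dbavgCov_apply, Rc_apply]
  group

/-- **(95) p. 32**: "(\widetilde{U₁^{v⁻¹}})_b = (\overline{R_{0,b₋}U₁})⁻¹Ũ_{1,b}R̄_{0,b}\overline{R_{0,b₊}U₁} = U̿₁" for
`v(x) = \overline{R_{0,x}U₁}` — the double-bar average IS the average `~` of the field moved by the INVERSE block frames
(here `v⁻¹ = w⁻¹` extended to every site by the same formula (82), which is immaterial by (93)).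
[cite: Balaban1985Averaging, (95) p.32, (94) p.32] -/
theorem tild_mgauge_inv_wframe (L : ℕ) (V₀ V₁ : Site d → Fin d → 𝔸ˣ) :
    tild L V₀ (mgauge V₀ (fun x => (wframe L V₀ V₁ x)⁻¹) V₁) = dbavgCov L V₀ V₁ := by
  funext q κ
  rw [tild_mgauge, dbavgCov_apply, map_inv, inv_inv]

/-- (92) at `k = 1` read on the unit lattice `Ω^{(1)} ≅ ℤ^d` (`rescale`): `Ũ₁ = (U̿₁)^{w}` — the rescaled `Ṽ₁` IS the moving-frame
transform (55), relative to the averaged background `V̄₀`, of the rescaled double-bar average by the block frames.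
[cite: Balaban1985Averaging, (92) p.31, (55) p.27] -/
theorem rescale_tild_eq_mgauge (L : ℕ) (V₀ V₁ : Site d → Fin d → 𝔸ˣ) :
    rescale L (tild L V₀ V₁)
      = mgauge (rescale L (bavg L V₀)) (fun z => wframe L V₀ V₁ ((L : ℤ) • z)) (rescale L (dbavgCov L V₀ V₁)) := by
  funext z κ
  rw [rescale_apply, tild_eq_frame_dbavgCov, mgauge_apply, rescale_apply, rescale_apply, smul_add]

/-! ### The flat background `V₀ = 1`: reduction to `B7Prop3Flat` -/

omit [CompleteSpace 𝔸] in
/-- `Fcov_one_left`: at `V₀ = 1` the exponent is (110) `F(y) = Σ L^{−d} log V₁(Γ_{y,x})` (`B7Prop3Flat.Favg`).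
[cite: Balaban1985Averaging, (110) p.34, (82) p.30] -/
@[simp] theorem Fcov_one_left (L : ℕ) (V₁ : Site d → Fin d → 𝔸ˣ) (y : Site d) :
    Fcov L (1 : Site d → Fin d → 𝔸ˣ) V₁ y = Favg L V₁ y := by
  simp [Fcov, Favg]

/-- `wframe_one_left`: at `V₀ = 1` the block frame is `B7Prop3Flat.vframe`. [cite: Balaban1985Averaging, (110) p.34, (82) p.30] -/
@[simp] theorem wframe_one_left (L : ℕ) (V₁ : Site d → Fin d → 𝔸ˣ) (y : Site d) :
    wframe L (1 : Site d → Fin d → 𝔸ˣ) V₁ y = vframe L V₁ y := by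
  simp [wframe, vframe]

/-- `tild_one_left`: at `V₀ = 1`, `Ṽ₁ = V̄₁` (`1̄ = 1`; cf. (120) p. 35 as read by gen 16 in `B7Prop3Flat.dbavg`).
[cite: Balaban1985Averaging, (65) p.29, (120) p.35] -/
@[simp] theorem tild_one_left (L : ℕ) (V₁ : Site d → Fin d → 𝔸ˣ) :
    tild L (1 : Site d → Fin d → 𝔸ˣ) V₁ = bavg L V₁ := by
  funext q κ
  simp [bavg_one]

/-- `dbavgCov_one_left`: at `V₀ = 1` the double-bar average (89) is `B7Prop3Flat.dbavg` (`V̄₀ = 1`, `R̄_{0,c} = id`,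
`Ṽ₁ = V̄₁`; cf. (120) p. 35 as read by gen 16). [cite: Balaban1985Averaging, (89) p.31, (120) p.35] -/
@[simp] theorem dbavgCov_one_left (L : ℕ) (V₁ : Site d → Fin d → 𝔸ˣ) :
    dbavgCov L (1 : Site d → Fin d → 𝔸ˣ) V₁ = dbavg L V₁ := by
  funext q κ
  simp [dbavgCov_apply, dbavg, bavg_one]

/-! ### Dictionary to the abstract transfer skeleton `B7Transfer` (arbitrary group, arbitrary recipe) -/

omit [NormedAlgebra ℂ 𝔸] [CompleteSpace 𝔸] in
/-- The concrete moving-frame action (55) is the abstract `B7Transfer.frame` over the bonds `(x, κ) ≙ ⟨x, x + e_κ⟩` with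
`ρ_b = R(V_{0,b})`. [cite: Balaban1985Averaging, (55) p.27] -/
theorem frame_eq_mgauge (V₀ : Site d → Fin d → 𝔸ˣ) (v : Site d → 𝔸ˣ) (Y : Site d × Fin d → 𝔸ˣ) :
    B7Transfer.frame (fun b : Site d × Fin d => b.1) (fun b => b.1 + e b.2) (fun b => Rc (V₀ b.1 b.2)) v Y
      = Function.uncurry (mgauge V₀ v (Function.curry Y)) := by
  funext ⟨x, κ⟩
  simp [B7Transfer.frame_apply, Function.curry]

/-- The concrete double-bar average (89) is the abstract `B7Transfer.dbar` with `avg = Ṽ` (65), `σ_c = R̄_{0,c} = R((V̄₀)_c)`,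
`w = \overline{R_{0,·}V₁}` (82), on the `L`-bonds `(q, κ) ≙ ⟨q, q + Le_κ⟩`. [cite: Balaban1985Averaging, (89) p.31] -/
theorem dbar_eq_dbavgCov (L : ℕ) (V₀ : Site d → Fin d → 𝔸ˣ) (Y : Site d × Fin d → 𝔸ˣ) :
    B7Transfer.dbar (fun c : Site d × Fin d => c.1) (fun c => c.1 + (L : ℤ) • e c.2) (fun c => Rc (bavg L V₀ c.1 c.2))
        (fun Y c => tild L V₀ (Function.curry Y) c.1 c.2) (fun Y y => wframe L V₀ (Function.curry Y) y) Y
      = Function.uncurry (dbavgCov L V₀ (Function.curry Y)) := by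
  funext ⟨q, κ⟩
  simp only [B7Transfer.dbar_apply, Function.uncurry_apply_pair, dbavgCov_apply]

/-- **The covariance hypothesis `hcov` of `B7Transfer.step98` HOLDS for B7's own average (42)** — in the abstract file it is an
explicit binder ("for B7's own average (15)/(41) they are the printed (93)"); here it is a theorem (`tild_mgauge`).
[cite: Balaban1985Averaging, (93) p.32] -/
theorem hcov_concrete (L : ℕ) (V₀ : Site d → Fin d → 𝔸ˣ) (v : Site d → 𝔸ˣ) (Y : Site d × Fin d → 𝔸ˣ) :
    (fun c : Site d × Fin d => tild L V₀ (Function.curry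
        (B7Transfer.frame (fun b : Site d × Fin d => b.1) (fun b => b.1 + e b.2) (fun b => Rc (V₀ b.1 b.2)) v Y)) c.1 c.2)
      = B7Transfer.frame (fun c : Site d × Fin d => c.1) (fun c => c.1 + (L : ℤ) • e c.2)
          (fun c => Rc (bavg L V₀ c.1 c.2)) v (fun c => tild L V₀ (Function.curry Y) c.1 c.2) := by
  funext ⟨q, κ⟩
  rw [frame_eq_mgauge, Function.curry_uncurry, tild_mgauge, B7Transfer.frame_apply]

end OneStep

/-! ## §3 The `k`-fold objects (69), (90)/(91), (97) at an arbitrary background `U₀` and the FUNDAMENTAL EQUALITY (92)/(97) -/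

section Iterates

variable {𝔸 : Type*} [NormedRing 𝔸] [NormedAlgebra ℂ 𝔸] [CompleteSpace 𝔸]

/-- **(69)** p. 29: "Ũ′^j_b = (\overline{U′U₀})^j_b(Ū₀^j)_b⁻¹" — the `j`-fold average (43) of the product with the `j`-fold
averaged background removed, on the bonds of `Ω^{(j)} ≅ ℤ^d`. [cite: Balaban1985Averaging, (69) p.29, (43) p.24] -/
def tildIter (L : ℕ) (U₀ U₁ : Site d → Fin d → 𝔸ˣ) (j : ℕ) : Site d → Fin d → 𝔸ˣ :=
  fun z κ => avgIter L (U₁ * U₀) j z κ * (avgIter L U₀ j z κ)⁻¹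

/-- **(90)/(91)** p. 31: "U̿₁ = \overline{\overline{R(U₀)U₁}}", "U̿₁^{j+1} = \overline{\overline{R(Ū₀^j)U̿₁^j}}, i.e., it is a
composition of the operation (89) for V₀ = Ū₀^j and of the j-th order operation U̿₁^j" — with `Ū₀^j = avgIter L U₀ j` and every
level read on the unit lattice (`rescale`). At `U₀ = 1`: `B7Prop4Flat.dbavgIter` (`dbavgCovIter_one_left`).
[cite: Balaban1985Averaging, (90)–(91) p.31] -/
def dbavgCovIter (L : ℕ) (U₀ U₁ : Site d → Fin d → 𝔸ˣ) : ℕ → Site d → Fin d → 𝔸ˣ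
  | 0 => U₁
  | j + 1 => rescale L (dbavgCov L (avgIter L U₀ j) (dbavgCovIter L U₀ U₁ j))

/-- **(97)** p. 32, the accumulated frame: "v_j(x) = (\overline{R_{0,x}U₁})(\overline{R̄_{0,x}U̿₁})·…·(\overline{R̄^{j−1}_{0,x}U̿₁^{j−1}})"
((160) p. 42 is the same product), recursively `v_0 = 1`, `v_{j+1}(z) = v_j(Lz)·\overline{R̄^j_{0,Lz}U̿₁^j}`, the new factor being
the block frame (82) of `U̿₁^j` at the background `Ū₀^j`. At `U₀ = 1`: `B7Prop6Flat.vprod` (`vcov_one_left`).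
[cite: Balaban1985Averaging, (97) p.32, (160) p.42] -/
def vcov (L : ℕ) (U₀ U₁ : Site d → Fin d → 𝔸ˣ) : ℕ → Site d → 𝔸ˣ
  | 0 => fun _ => 1
  | j + 1 => fun z => vcov L U₀ U₁ j ((L : ℤ) • z) * wframe L (avgIter L U₀ j) (dbavgCovIter L U₀ U₁ j) ((L : ℤ) • z)

/-- `tildIter_apply`: (69) unfolded. [cite: Balaban1985Averaging, (69) p.29] -/
@[simp] theorem tildIter_apply (L : ℕ) (U₀ U₁ : Site d → Fin d → 𝔸ˣ) (j : ℕ) (z : Site d) (κ : Fin d) :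
    tildIter L U₀ U₁ j z κ = avgIter L (U₁ * U₀) j z κ * (avgIter L U₀ j z κ)⁻¹ := rfl

/-- `dbavgCovIter_zero`: `U̿₁^0 = U₁`. [cite: Balaban1985Averaging, (90) p.31] -/
@[simp] theorem dbavgCovIter_zero (L : ℕ) (U₀ U₁ : Site d → Fin d → 𝔸ˣ) : dbavgCovIter L U₀ U₁ 0 = U₁ := rfl

/-- `dbavgCovIter_succ`: (91) bondwise. [cite: Balaban1985Averaging, (91) p.31] -/
theorem dbavgCovIter_succ (L : ℕ) (U₀ U₁ : Site d → Fin d → 𝔸ˣ) (j : ℕ) (z : Site d) (κ : Fin d) :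
    dbavgCovIter L U₀ U₁ (j + 1) z κ = dbavgCov L (avgIter L U₀ j) (dbavgCovIter L U₀ U₁ j) ((L : ℤ) • z) κ := rfl

/-- `vcov_zero`: `v_0 = 1`. [cite: Balaban1985Averaging, (97) p.32] -/
@[simp] theorem vcov_zero (L : ℕ) (U₀ U₁ : Site d → Fin d → 𝔸ˣ) (z : Site d) : vcov L U₀ U₁ 0 z = 1 := rfl

/-- `vcov_succ`: `v_{j+1}(z) = v_j(Lz)·\overline{R̄^j_{0,Lz}U̿₁^j}`. [cite: Balaban1985Averaging, (97) p.32] -/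
theorem vcov_succ (L : ℕ) (U₀ U₁ : Site d → Fin d → 𝔸ˣ) (j : ℕ) (z : Site d) :
    vcov L U₀ U₁ (j + 1) z
      = vcov L U₀ U₁ j ((L : ℤ) • z) * wframe L (avgIter L U₀ j) (dbavgCovIter L U₀ U₁ j) ((L : ℤ) • z) := rfl

/-- `Ũ^0 = U₁`. [cite: Balaban1985Averaging, (69) p.29] -/
@[simp] theorem tildIter_zero' (L : ℕ) (U₀ U₁ : Site d → Fin d → 𝔸ˣ) : tildIter L U₀ U₁ 0 = U₁ := by
  funext z κ
  simp

/-- (69) read as `Ũ^j·Ū₀^j = (\overline{U₁U₀})^j`. [cite: Balaban1985Averaging, (69) p.29] -/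
theorem tildIter_mul (L : ℕ) (U₀ U₁ : Site d → Fin d → 𝔸ˣ) (j : ℕ) :
    tildIter L U₀ U₁ j * avgIter L U₀ j = avgIter L (U₁ * U₀) j := by
  funext z κ
  simp

/-- **(68)** p. 29: "Ũ′^{j+1}_c = (\overline{Ũ′^jŪ₀^j})_c(\overline{Ū₀^j})_c⁻¹" — the `(j+1)`-st object is the one-step
operation (65) at the background `Ū₀^j` applied to the `j`-th. [cite: Balaban1985Averaging, (68) p.29] -/
theorem tildIter_succ (L : ℕ) (U₀ U₁ : Site d → Fin d → 𝔸ˣ) (j : ℕ) (z : Site d) (κ : Fin d) :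
    tildIter L U₀ U₁ (j + 1) z κ = tild L (avgIter L U₀ j) (tildIter L U₀ U₁ j) ((L : ℤ) • z) κ := by
  rw [tildIter_apply, tild_apply, tildIter_mul, avgIter_succ, avgIter_succ, rescale_apply, rescale_apply]

/-- **THE FUNDAMENTAL EQUALITY (92)/(97) p. 31–32 AT AN ARBITRARY BACKGROUND, AS AN IDENTITY OF THE FORMAL OBJECTS**
(any `L`, any `j`, any unit-valued `U₀`, `U₁`; no smallness, no unitarity): "(Ũ₁^j)_b = v_j(b₋)(U̿₁^j)_bR̄^j_{0,b}v_j⁻¹(b₊) =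
(U̿₁^j)^{v_j}_b" — `Ũ^j` IS the moving-frame transform (55), relative to `Ū₀^j`, of the `j`-fold double-bar average (91)
by the accumulated frame (97).  Proof = print's induction (96)–(98): the step uses ONLY (68), the covariance (93)
(`tild_mgauge`) and (89) solved (`tild_eq_frame_dbavgCov`) — abstractly `B7Transfer.step98`.  The identification
(99)–(100) of `v_j` with the recursive block averages (85) is not restated here (`vcov` is (97) read directly).
[cite: Balaban1985Averaging, (92) p.31, (97) p.32, (96)–(98) p.32] -/
theorem tildIter_eq_mgauge (L : ℕ) (U₀ U₁ : Site d → Fin d → 𝔸ˣ) :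
    ∀ j : ℕ, tildIter L U₀ U₁ j = mgauge (avgIter L U₀ j) (vcov L U₀ U₁ j) (dbavgCovIter L U₀ U₁ j)
  | 0 => by
    funext z κ
    simp
  | j + 1 => by
    funext z κ
    rw [tildIter_succ, tildIter_eq_mgauge L U₀ U₁ j, tild_mgauge, tild_eq_frame_dbavgCov, mgauge_apply,
      vcov_succ, vcov_succ, dbavgCovIter_succ, avgIter_succ, rescale_apply, smul_add]
    simp only [map_mul, mul_inv_rev, mul_assoc, Rc_apply]

/-- **(88)/(92) = (159) AT AN ARBITRARY BACKGROUND**: the `k`-fold average (43) of the product `U₁U₀` is the ORDINARY gauge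
transform (8), by the accumulated frame `v_k` (97)/(160), of the product `U̿₁^k·Ū₀^k` of the `k`-fold double-bar average
(91) with the `k`-fold averaged background: `(\overline{U₁U₀})^k = (U̿₁^kŪ₀^k)^{v_k}`, i.e. bondwise
`Ū^k(b) = v_k(b₋)·U̿₁^k(b)·Ū₀^k(b)·v_k(b₊)⁻¹` (print (88): "Ū^k_b(Ū₀^k)_b⁻¹ = (\overline{U′U₀^k})_b(Ū₀^k)_b⁻¹ = … ", (159):
"Ū^k_b(Ū^k_0)_b⁻¹ = … = v_k(b₋)(U̿′^k)_bR̄^k_{0,b}v_k⁻¹(b₊)").  At `U₀ = 1` this is `B7Prop6Flat.avgIter_eq_gaugeAct_vprod`.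
[cite: Balaban1985Averaging, (88) p.31, (92) p.31, (159) p.42] -/
theorem avgIter_mul_eq_gaugeAct (L : ℕ) (U₀ U₁ : Site d → Fin d → 𝔸ˣ) (k : ℕ) :
    avgIter L (U₁ * U₀) k = gaugeAct (vcov L U₀ U₁ k) (dbavgCovIter L U₀ U₁ k * avgIter L U₀ k) := by
  rw [← tildIter_mul, tildIter_eq_mgauge, mgauge_mul]

/-- (159) at an arbitrary background, bondwise in `𝔸`: `Ū^k(c) = v_k(c₋)·U̿₁^k(c)·Ū₀^k(c)·v_k(c₊)⁻¹`, `c = ⟨z, z + e_κ⟩` a bond of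
`Ω^{(k)} ≅ ℤ^d`, `Ū^k` the `k`-fold average of `U = U₁U₀`. [cite: Balaban1985Averaging, (159) p.42, (92) p.31] -/
theorem val_avgIter_mul_eq (L : ℕ) (U₀ U₁ : Site d → Fin d → 𝔸ˣ) (k : ℕ) (z : Site d) (κ : Fin d) :
    ((avgIter L (U₁ * U₀) k z κ : 𝔸ˣ) : 𝔸)
      = (vcov L U₀ U₁ k z : 𝔸) * (dbavgCovIter L U₀ U₁ k z κ : 𝔸) * (avgIter L U₀ k z κ : 𝔸)
          * (((vcov L U₀ U₁ k (z + e κ))⁻¹ : 𝔸ˣ) : 𝔸) := by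
  rw [avgIter_mul_eq_gaugeAct L U₀ U₁ k]
  simp only [gaugeAct, Pi.mul_apply, Units.val_mul, mul_assoc]

/-- **(70)/(71)** p. 29, gauge covariance of the `j`-fold objects under an invertible gauge function `u` of the ORIGINAL lattice
(`u_j(z) = u(L^jz)`, `B7AvgGaugeCovariance.uLev`): "Ũ′^j_b = (Ũ₁^u)^j_b = u(b₋)(Ũ₁)^j_bR̄^j_{0,b}u⁻¹(b₊), b ⊂ Ω^{(j)}. (71)"
for `U′ = U₁^u` in the moving frame of `U₀` — from (11) for the product ((70): "Ū^j_b = (\overline{U₁^uU₀})^j_b =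
u(b₋)(\overline{U₁U₀})^j_bu⁻¹(b₊), b ⊂ Ω^{(j)}", `B7Prop6Flat.avgIter_gaugeAct_units`).
[cite: Balaban1985Averaging, (70)–(71) p.29, (11) p.19] -/
theorem tildIter_mgauge (L : ℕ) (U₀ U₁ : Site d → Fin d → 𝔸ˣ) (u : Site d → 𝔸ˣ) (j : ℕ) :
    tildIter L U₀ (mgauge U₀ u U₁) j = mgauge (avgIter L U₀ j) (uLev L u j) (tildIter L U₀ U₁ j) := by
  funext z κ
  rw [tildIter_apply, mgauge_mul, avgIter_gaugeAct_units, mgauge_apply, tildIter_apply]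
  simp only [gaugeAct, Rc_apply]
  group

/-! ### The flat background `U₀ = 1`: reduction to `B7Prop4Flat` / `B7Prop6Flat` -/

/-- `avgIter_one`: `1̄^j = 1`. [cite: Balaban1985Averaging, (43) p.24] -/
@[simp] theorem avgIter_one (L : ℕ) : ∀ j : ℕ, avgIter L (1 : Site d → Fin d → 𝔸ˣ) j = 1
  | 0 => rfl
  | j + 1 => by
    funext z κ
    rw [avgIter_succ, rescale_apply, avgIter_one L j, bavg_one]
    rfl

/-- `dbavgCovIter_one_left`: at `U₀ = 1`, (90)/(91) is `B7Prop4Flat.dbavgIter`. [cite: Balaban1985Averaging, (90)–(91) p.31] -/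
@[simp] theorem dbavgCovIter_one_left (L : ℕ) (U₁ : Site d → Fin d → 𝔸ˣ) :
    ∀ j : ℕ, dbavgCovIter L (1 : Site d → Fin d → 𝔸ˣ) U₁ j = dbavgIter L U₁ j
  | 0 => rfl
  | j + 1 => by
    funext z κ
    rw [dbavgCovIter_succ, dbavgIter_succ, avgIter_one, dbavgCov_one_left, dbavgCovIter_one_left L U₁ j]

/-- `vcov_one_left`: at `U₀ = 1`, the accumulated frame (97) is (160) `B7Prop6Flat.vprod`. [cite: Balaban1985Averaging, (97) p.32, (160) p.42] -/
@[simp] theorem vcov_one_left (L : ℕ) (U₁ : Site d → Fin d → 𝔸ˣ) :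
    ∀ j : ℕ, vcov L (1 : Site d → Fin d → 𝔸ˣ) U₁ j = vprod L U₁ j
  | 0 => rfl
  | j + 1 => by
    funext z
    rw [vcov_succ, vprod_succ, avgIter_one, wframe_one_left, dbavgCovIter_one_left, vcov_one_left L U₁ j]

/-- `tildIter_one_left`: at `U₀ = 1`, `Ũ^j = Ū₁^j`. [cite: Balaban1985Averaging, (69) p.29] -/
@[simp] theorem tildIter_one_left (L : ℕ) (U₁ : Site d → Fin d → 𝔸ˣ) (j : ℕ) :
    tildIter L (1 : Site d → Fin d → 𝔸ˣ) U₁ j = avgIter L U₁ j := by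
  funext z κ
  simp

/-- Consistency with gen 18/19 of the lineage: at `U₀ = 1` the fundamental equality (97) is (159) at the flat background,
`Ū₁^k = (U̿₁^k)^{v_k}` — `B7Prop6Flat.avgIter_eq_gaugeAct_vprod`, re-derived from `tildIter_eq_mgauge`.
[cite: Balaban1985Averaging, (159) p.42, (97) p.32] -/
theorem avgIter_eq_gaugeAct_vprod' (L : ℕ) (U₁ : Site d → Fin d → 𝔸ˣ) (k : ℕ) :
    avgIter L U₁ k = gaugeAct (vprod L U₁ k) (dbavgIter L U₁ k) := by
  have h := tildIter_eq_mgauge L (1 : Site d → Fin d → 𝔸ˣ) U₁ k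
  simpa using h

/-! ### Sanity instances (`k = 1`): (90) and the first frame -/

/-- (90): `U̿₁ = \overline{\overline{R(U₀)U₁}}` is the one-step (89) read on `Ω^{(1)} ≅ ℤ^d`. [cite: Balaban1985Averaging, (90) p.31] -/
example (L : ℕ) (U₀ U₁ : Site d → Fin d → 𝔸ˣ) : dbavgCovIter L U₀ U₁ 1 = rescale L (dbavgCov L U₀ U₁) := rfl

/-- (97) at `j = 1`: `v_1(x) = \overline{R_{0,x}U₁}`, and the fundamental equality at `j = 1` is (92) at `k = 1`
(`rescale_tild_eq_mgauge`). [cite: Balaban1985Averaging, (97) p.32, (92) p.31] -/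
example (L : ℕ) (U₀ U₁ : Site d → Fin d → 𝔸ˣ) (z : Site d) : vcov L U₀ U₁ 1 z = wframe L U₀ U₁ ((L : ℤ) • z) := by
  rw [vcov_succ, vcov_zero, one_mul, avgIter_zero, dbavgCovIter_zero]

example (L : ℕ) (U₀ U₁ : Site d → Fin d → 𝔸ˣ) :
    rescale L (tild L U₀ U₁) = mgauge (avgIter L U₀ 1) (vcov L U₀ U₁ 1) (dbavgCovIter L U₀ U₁ 1) := by
  rw [← tildIter_eq_mgauge L U₀ U₁ 1]
  funext z κ
  rw [rescale_apply, tildIter_succ, tildIter_zero', avgIter_zero]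

end Iterates

end Literature.MathematicalPhysics.QuantumFieldTheory.Balaban1983to89.B7Eq92Concrete
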